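import Literature.AnabelianGeometry.SemiGraphs.ThetaRayCritical
import Literature.AnabelianGeometry.SemiGraphs.ThetaRayEscapeLevelData
import Literature.AnabelianGeometry.SemiGraphs.TemperedMaximalCompact
import Literature.AnabelianGeometry.SemiGraphs.TemperedEscapeOfHeights
import Literature.AnabelianGeometry.SemiGraphs.TreeSystemFixedPointTopological
import Literature.AnabelianGeometry.SemiGraphs.TemperedPiBranchStabilizerRecentred
import Literature.AnabelianGeometry.SemiGraphs.TemperedPiLimitHom
import HarnessLib

/-!
# The escaping procyclic subgroup `C = closure⟨c⟩` of `π₁^temp(𝒢_θ)` is ITSELF a maximal compact subgroup,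
# parametrised by a continuous `ζ : E →ₜ* π₁^temp(𝒢_θ)` ([SemiAnbd] Thm 3.7 (iii)/(iv) p. 41 at the
# countermodel `𝒢_θ`; the `hrigid` seam of the (iv) refutation, discharged)

Mochizuki, *Semi-graphs of anabelioids*, Publ. RIMS **42** (2006) [MochizukiSemiAnbd2006], §3, Theorem 3.7
(iii)/(iv), author's manuscript pp. 40–41 [cite: MochizukiSemiAnbd2006, Thm 3.7(iv) p.41]; the printed proof
concerns FINITE underlying semi-graphs (kernel: `compactInVerticialAt_of_finiteGraph`,
`maximalCompactIffVerticialAt_of_finiteGraph`); the cell's ∀-countable typings F-1732 / F-1750 are refuted at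
abc-iut-L3-d1's countermodel `𝒢_θ(p, n)` (p442260 `not_compactInVerticial`, p443103
`not_maximalCompactIffVerticial` — Zorn route).

PROOF-ONLY file (abc-iut cell, F-wave seat abc-iut-f-175 gen 2; 0 definitions, no named fact, no hypothesis
in the generic section).  The Zorn-FREE sharpening asked for by abc-iut-w6-d063's
`TemperedMaximalCompactSelfOfEscaping.lean` (binder `hrigid`), in the form needed to decide the ∀-countable
typed forms of [SemiAnbd] Cor 3.9 (F-2770 `QuasiGeometricGraphDataCompat`, F-2771 `Cor39Compat`):

* `thetaRay_exists_maximalCompact_escaping_of_hcrit` — for `thetaRay G E up low` satisfying Thm 3.7's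
  hypotheses, `E = closure⟨e₀⟩` topologically cyclic, (hcoin) and (hcrit) as in abc-iut-L3-t11's
  `thetaRay_not_compactInVerticialAt_of_hcrit`: there is a CONTINUOUS homomorphism `ζ : E →ₜ* π₁^temp(𝒢_θ)`
  (the limit of the edge homomorphisms `ψ_{k+1} ∘ up` of the apartment, `TemperedPiLimitHom.lean`) whose range
  `C = closure⟨ζ e₀⟩` is a MAXIMAL COMPACT SUBGROUP contained in NO verticial subgroup.  Maximality is the
  cardinality squeeze: a compact `K ⊇ C` fixes at every level `j` a FAR edge (abc-iut-w6-d063's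
  `exists_forall_mem_fixed_far_edge_of_heightEscape`), so `ρ_j(K)` lies in ONE cyclic group
  `⟨σ_j^{b_*(e₀)}⟩` (the re-centred branch-stabiliser dictionary, `TemperedPiBranchStabilizerRecentred.lean`)
  whose order is that of `ρ_j(c)` (uniform point stabilisers + the edge-group transfer between the two
  branches of the far edge + `ρ_j(z_m) = ρ_j(c)` for `m ≫ 0`); hence `ρ_j(K) = ⟨ρ_j(c)⟩` for all `j`, and
  `K ⊆ closure⟨c⟩ = C`;
* `thetaRay_exists_maximalCompact_escaping_of_levelEscape` — the same for an abstract sequence `z` EQUAL to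
  the apartment generators (binder `hzap`) with abc-iut-L3-d4's level binders (hz) (hfar) (hcrit).
The character form and the instantiation at `𝒢_θ(p, n)` (`E = ℤ_p`, `e₀ = 1`) are the companion file
`ThetaRayMaximalCompactEscapingFreeProP.lean`.

The first section carries PRIVATE copies (subtype-quantified restatements, proofs verbatim) of three lemmas of
abc-iut-w6-d063's `TemperedMaximalCompactSelfOfEscaping.lean` (p442570: a compact subgroup fixes a level-tree
vertex; two fixed vertices give a fixed edge; the far fixed edge under height escape) — that module had no olean
on the farm when this file was checked (build incoherence), so it is not imported; credit and statements are his.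

HONEST FRAMING: an erratum-grade statement about the ∀-countable TYPING of Thm 3.7 (iii)/(iv) (finite graphs:
positive kernel theorems); it refutes nothing in the IUT corpus and bears in no way on [IUTchIII] Cor. 3.12.
-/

noncomputable section

namespace Literature.AnabelianGeometry.SemiGraphs

open CategoryTheory Topology Multiplicative
open ProfiniteSemiGraph ProfiniteSemiGraph.GaloisLevelData

/-! ### Private copies of abc-iut-w6-d063's far-fixed-edge lemmas (p442570, no olean at check time) -/

namespace ProfiniteSemiGraph

namespace VerticialLevelData

universe v u

variable {𝒢 : ProfiniteSemiGraph.{u}} {c : TemperedPiChart 𝒢} (D : VerticialLevelData.{v} 𝒢 c)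

/-- A compact subgroup of `π₁^temp(𝒢)` fixes a vertex of every level tree (abc-iut-w6-d063,
`exists_forall_mem_fixed_vertex_of_isCompact`, subtype form). [cite: MochizukiSemiAnbd2006, Thm 3.7(iii) p.41] -/
private theorem fixedVertex_of_isCompact (K : Subgroup c.G) (hK : IsCompact (K : Set c.G)) (j : D.J) :
    ∃ y : (D.tree j).Vertex, ∀ k : K, (D.act j (k : c.G)).hom.vertexMap y = y :=
  SemiGraph.exists_fixed_vertex_of_isCompact_over K hK (D.isTree j) (D.vertex j)
    (D.proj j) (D.act j) (D.isOpen_ker j) (D.act_over j)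

/-- Lemma 1.8 (ii)(b) for a subgroup: two distinct common fixed vertices give a common fixed edge at the
first one (abc-iut-w6-d063, `exists_forall_mem_fixed_edge_of_two_fixed_vertices`, subtype form).
[cite: MochizukiSemiAnbd2006, Lem. 1.8(ii) p.20] -/
private theorem fixedEdge_of_two_fixedVertices (K : Subgroup c.G) (j : D.J)
    {y w : (D.tree j).Vertex} (hne : y ≠ w) (hy : ∀ k : K, (D.act j (k : c.G)).hom.vertexMap y = y)
    (hw : ∀ k : K, (D.act j (k : c.G)).hom.vertexMap w = w) :
    ∃ b : (D.tree j).Branch, (D.tree j).abuts b = some y ∧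
      ∀ k : K, (D.act j (k : c.G)).hom.edgeMap ((D.tree j).edgeOf b) = (D.tree j).edgeOf b := by
  classical
  have hT := (D.isTree j).isTree
  let p : (D.tree j).subdivision.Path (Sum.inl y) (Sum.inl w) :=
    (hT.connected (Sum.inl y) (Sum.inl w)).some.toPath
  have hall : ∀ k : K, ∀ z ∈ p.1.support, SemiGraph.nodeMap (D.act j (k : c.G)) z = z := fun k =>
    SemiGraph.nodeMap_eq_self_of_isPath hT.isAcyclic (D.act j (k : c.G)) (by simp [hy k]) (by simp [hw k])
      p.1 p.2
  have key : ∀ (u u' : (D.tree j).Node) (q : (D.tree j).subdivision.Walk u u'), u ≠ u' →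
      ∃ z ∈ q.support, (D.tree j).subdivision.Adj u z := by
    intro u u' q huu'
    cases q with
    | nil => exact absurd rfl huu'
    | cons h q' => exact ⟨_, by simp, h⟩
  obtain ⟨z, hz, hadj⟩ := key _ _ p.1 (fun h => hne (Sum.inl_injective h))
  change (SimpleGraph.fromRel (D.tree j).NodeRel).Adj _ _ at hadj
  rw [SimpleGraph.fromRel_adj] at hadj
  obtain ⟨-, h | h⟩ := hadj
  · cases h
  · cases h
    rename_i b hb
    refine ⟨b, hb, fun k => ?_⟩
    have hfix : (D.act j (k : c.G)).hom.branchMap b = b := by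
      have := hall k _ hz
      simpa only [SemiGraph.nodeMap_inr_inr, Sum.inr.injEq] using this
    rw [← (D.act j (k : c.G)).hom.edgeOf_branchMap b, hfix]

/-- The far common fixed edge under height escape (abc-iut-w6-d063,
`exists_forall_mem_fixed_far_edge_of_heightEscape`, subtype form): if `g ∈ K`, `K` compact, and the
`g`-fixed tree vertices escape to large height, then at every level `j` and for every `N` the elements of `K`
fix a common vertex `x` of height `≥ N` and an edge abutting to it. [cite: MochizukiSemiAnbd2006, Thm 3.7(iv) p.41] -/
private theorem fixedFarEdge_of_heightEscape (H : 𝒢.graph.Vertex → ℕ) (K : Subgroup c.G)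
    (hK : IsCompact (K : Set c.G)) (g : c.G) (hg : g ∈ K)
    (hesc : ∀ N : ℕ, ∃ j : D.J, ∀ y : (D.tree j).Vertex, (D.act j g).hom.vertexMap y = y →
      N ≤ H ((D.proj j).vertexMap y))
    (j : D.J) (N : ℕ) : ∃ (x : (D.tree j).Vertex) (b : (D.tree j).Branch),
      (D.tree j).abuts b = some x ∧ N ≤ H ((D.proj j).vertexMap x) ∧
      ∀ k : K, (D.act j (k : c.G)).hom.edgeMap ((D.tree j).edgeOf b) = (D.tree j).edgeOf b := by
  have hpt : ∀ ⦃i j : D.J⦄ (h : i ≤ j) (x : (D.tree j).Vertex),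
      (D.proj i).vertexMap ((D.trans h).vertexMap x) = (D.proj j).vertexMap x := fun i j h x => by
    have e := congrArg (fun φ => SemiGraph.Hom.vertexMap φ x) (D.trans_over h)
    simpa only [SemiGraph.comp_vertexMap, Function.comp_apply] using e
  obtain ⟨y, hy⟩ := D.fixedVertex_of_isCompact K hK j
  obtain ⟨j₁, hj₁⟩ := hesc (max N (H ((D.proj j).vertexMap y) + 1))
  obtain ⟨j₂, hjj₂, hj₁j₂⟩ := exists_ge_ge j j₁
  obtain ⟨y₂, hy₂⟩ := D.fixedVertex_of_isCompact K hK j₂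
  have hgt : max N (H ((D.proj j).vertexMap y) + 1) ≤ H ((D.proj j₂).vertexMap y₂) := by
    have hfix₁ : (D.act j₁ g).hom.vertexMap ((D.trans hj₁j₂).vertexMap y₂) =
        (D.trans hj₁j₂).vertexMap y₂ := by
      rw [← D.trans_act_vertexMap, hy₂ ⟨g, hg⟩]
    have h1 := hj₁ _ hfix₁
    rwa [hpt] at h1
  set w : (D.tree j).Vertex := (D.trans hjj₂).vertexMap y₂ with hw_def
  have hw : ∀ k : K, (D.act j (k : c.G)).hom.vertexMap w = w := fun k => by
    rw [hw_def, ← D.trans_act_vertexMap, hy₂ k]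
  have hHw : H ((D.proj j).vertexMap w) = H ((D.proj j₂).vertexMap y₂) := by
    rw [hw_def, hpt]
  have hne : w ≠ y := by
    intro h
    have h' := congrArg (fun x => H ((D.proj j).vertexMap x)) h
    simp only [hHw] at h'
    omega
  obtain ⟨b, hb, hfix⟩ := D.fixedEdge_of_two_fixedVertices K j hne hw hy
  exact ⟨w, b, hb, by rw [hHw]; omega, hfix⟩

end VerticialLevelData

end ProfiniteSemiGraph

/-! ### Generic ray of groups -/

section Generic

variable {G E : Type} [Group G] [TopologicalSpace G] [IsTopologicalGroup G] [CompactSpace G]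
  [TotallyDisconnectedSpace G] [Group E] [TopologicalSpace E] [IsTopologicalGroup E] [CompactSpace E]
  [TotallyDisconnectedSpace E] {up : E →ₜ* G} {low : ℕ → (E →ₜ* G)}

/-- Two cyclic subgroups of equal finite order, one inside the other, are equal. [folklore] -/
private theorem zpowers_eq_zpowers_of_mem_of_orderOf_eq {Γ : Type*} [Group Γ] {x u : Γ}
    (hx : x ∈ Subgroup.zpowers u) (hord : orderOf x = orderOf u) (hfin : IsOfFinOrder u) :
    Subgroup.zpowers x = Subgroup.zpowers u := by
  have hle : Subgroup.zpowers x ≤ Subgroup.zpowers u := (Subgroup.zpowers_le (G := Γ)).mpr hx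
  haveI : Finite (Subgroup.zpowers u) :=
    Nat.finite_of_card_ne_zero (by rw [Nat.card_zpowers]; exact hfin.orderOf_pos.ne')
  exact Subgroup.eq_of_le_of_card_ge hle (by rw [Nat.card_zpowers, Nat.card_zpowers, hord])

/-- **The escaping procyclic `C` of `𝒢_θ` is a MAXIMAL compact subgroup lying in no verticial subgroup**,
LEVEL-DATA form: for a base point sequence `P₀` and a sequence `z` which IS the sequence of apartment
generators `ψ_{k+1}(up e₀)` (binder `hzap`), with (hz) (hfar) (hcrit) as in abc-iut-L3-d4's
`thetaRay_not_compactInVerticialAt_of_levelEscape`; `E = closure⟨e₀⟩`.  See the module docstring for the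
squeeze. [cite: MochizukiSemiAnbd2006, Thm 3.7(iv) p.41] -/
theorem thetaRay_exists_maximalCompact_escaping_of_levelEscape
    (h37 : (thetaRay G E up low).Thm37Hypotheses) (e₀ : E)
    (hgen : (Subgroup.zpowers e₀).topologicalClosure = ⊤) :
    ∀ (P₀ : ((thetaRay G E up low).galoisLevelData h37.toProp36Hypotheses).PointSeq h37.isCountable (0 : ℕ))
      (z : ℕ → ((thetaRay G E up low).galoisLevelData h37.toProp36Hypotheses).temperedPi h37.isCountable),
      (∀ k, z k =
        (rayPointSeq (D := (thetaRay G E up low).galoisLevelData h37.toProp36Hypotheses) thetaRay_ham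
          thetaRay_hap thetaRay_hmp P₀ (k + 1)).decompHom
          ((thetaRay G E up low).brHom (k, true) (k + 1) (thetaRay_hap k) e₀)) →
      (∀ j : ℕ, ∃ N : ℕ, ∀ k, N ≤ k →
        ((thetaRay G E up low).galoisLevelData h37.toProp36Hypotheses).proj h37.isCountable j (z (k + 1)) =
          ((thetaRay G E up low).galoisLevelData h37.toProp36Hypotheses).proj h37.isCountable j (z k)) →
      (∀ k j : ℕ, ∃ x : (((thetaRay G E up low).galoisLevelData h37.toProp36Hypotheses).tree j).Vertex,
        k ≤ (((thetaRay G E up low).galoisLevelData h37.toProp36Hypotheses).treeProj j).vertexMap x ∧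
          (((thetaRay G E up low).galoisLevelData h37.toProp36Hypotheses).treeAct h37.isCountable j
            (z k)).hom.vertexMap x = x) →
      (∀ n : ℕ, ∃ j₀ : ℕ, ∀ j, j₀ ≤ j → ∃ N : ℕ, ∀ k, N ≤ k →
        ∀ (y : (((thetaRay G E up low).galoisLevelData h37.toProp36Hypotheses).tree j).Vertex)
          (b b' : (((thetaRay G E up low).galoisLevelData h37.toProp36Hypotheses).tree j).Branch),
          (((thetaRay G E up low).galoisLevelData h37.toProp36Hypotheses).tree j).abuts b = some y →
          (((thetaRay G E up low).galoisLevelData h37.toProp36Hypotheses).tree j).abuts b' = some y →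
          (((thetaRay G E up low).galoisLevelData h37.toProp36Hypotheses).treeProj j).vertexMap y = n + 1 →
          (((thetaRay G E up low).galoisLevelData h37.toProp36Hypotheses).treeAct h37.isCountable j
              (z k)).hom.edgeMap
            ((((thetaRay G E up low).galoisLevelData h37.toProp36Hypotheses).tree j).edgeOf b) =
            (((thetaRay G E up low).galoisLevelData h37.toProp36Hypotheses).tree j).edgeOf b →
          (((thetaRay G E up low).galoisLevelData h37.toProp36Hypotheses).treeAct h37.isCountable j
              (z k)).hom.edgeMap
            ((((thetaRay G E up low).galoisLevelData h37.toProp36Hypotheses).tree j).edgeOf b') =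
            (((thetaRay G E up low).galoisLevelData h37.toProp36Hypotheses).tree j).edgeOf b' →
          (∃ (b₂ : (((thetaRay G E up low).galoisLevelData h37.toProp36Hypotheses).tree j).Branch)
             (v₂ : (((thetaRay G E up low).galoisLevelData h37.toProp36Hypotheses).tree j).Vertex), b₂ ≠ b ∧
            (((thetaRay G E up low).galoisLevelData h37.toProp36Hypotheses).tree j).edgeOf b₂ =
              (((thetaRay G E up low).galoisLevelData h37.toProp36Hypotheses).tree j).edgeOf b ∧
            (((thetaRay G E up low).galoisLevelData h37.toProp36Hypotheses).tree j).abuts b₂ = some v₂ ∧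
            (((thetaRay G E up low).galoisLevelData h37.toProp36Hypotheses).treeProj j).vertexMap v₂ =
              n + 2) →
          (∃ (b₂ : (((thetaRay G E up low).galoisLevelData h37.toProp36Hypotheses).tree j).Branch)
             (v₂ : (((thetaRay G E up low).galoisLevelData h37.toProp36Hypotheses).tree j).Vertex), b₂ ≠ b' ∧
            (((thetaRay G E up low).galoisLevelData h37.toProp36Hypotheses).tree j).edgeOf b₂ =
              (((thetaRay G E up low).galoisLevelData h37.toProp36Hypotheses).tree j).edgeOf b' ∧
            (((thetaRay G E up low).galoisLevelData h37.toProp36Hypotheses).tree j).abuts b₂ = some v₂ ∧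
            (((thetaRay G E up low).galoisLevelData h37.toProp36Hypotheses).treeProj j).vertexMap v₂ = n) →
          False) →
    ∃ ζ : E →ₜ* ((thetaRay G E up low).temperedPiChart h37.toProp36Hypotheses).G,
      IsMaximalCompactSubgroup ζ.toMonoidHom.range ∧
      ¬ ∃ (v : ℕ) (H : Subgroup ((thetaRay G E up low).temperedPiChart h37.toProp36Hypotheses).G),
          H ∈ verticialSubgroups ((thetaRay G E up low).temperedPiChart h37.toProp36Hypotheses) v ∧
          ζ.toMonoidHom.range ≤ H := by
  set 𝒢 : ProfiniteSemiGraph.{0} := thetaRay G E up low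
  have h36 : 𝒢.Prop36Hypotheses := h37.toProp36Hypotheses
  set D : GaloisLevelData 𝒢 := 𝒢.galoisLevelData h37.toProp36Hypotheses with hD_def
  intro P₀ z hzap hz hfar hcrit
  -- the edge homomorphisms `ζ_k := ψ_{k+1} ∘ up` and their limit `ζ`
  set ζs : ℕ → (E →ₜ* D.temperedPi h36.isCountable) := fun k =>
    (rayPointSeq (D := D) thetaRay_ham thetaRay_hap thetaRay_hmp P₀ (k + 1)).decompHomCont.comp
      (𝒢.brHom (k, true) (k + 1) (thetaRay_hap k)) with hζs_def
  have hζz : ∀ k, ζs k e₀ = z k := fun k => by rw [hzap k, hζs_def]; rfl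
  have hzζ : ∀ n, ∃ N, ∀ k, N ≤ k →
      D.proj h36.isCountable n (ζs (k + 1) e₀) = D.proj h36.isCountable n (ζs k e₀) := by
    intro n
    obtain ⟨N, hN⟩ := hz n
    exact ⟨N, fun k hk => by rw [hζz, hζz]; exact hN k hk⟩
  obtain ⟨ζ, hζ, hrange, hcpt⟩ := D.exists_limitHom_range h36.isCountable ζs e₀ hgen hzζ
  choose N hN using hζ
  have hcC : ζ e₀ ∈ ζ.toMonoidHom.range := ⟨e₀, rfl⟩
  -- `ρ_j (ζ e₀) = ρ_j z_k` for `k ≥ N j`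
  have hcz : ∀ j k, N j ≤ k → D.proj h36.isCountable j (ζ e₀) = D.proj h36.isCountable j (z k) :=
    fun j k hk => by rw [hN j k hk e₀, hζz]
  have hact : ∀ j k, N j ≤ k →
      D.treeAct h36.isCountable j (ζ e₀) = D.treeAct h36.isCountable j (z k) := fun j k hk => by
    rw [D.treeAct_apply h36.isCountable, D.treeAct_apply h36.isCountable]
    exact congrArg _ (hcz j k hk)
  -- (hfar), (hcrit) for `c := ζ e₀`
  have hfar_c : ∀ (j : ℕ) (m : ℕ), ∃ x : (D.tree j).Vertex,
      m ≤ (D.treeProj j).vertexMap x ∧ (D.treeAct h36.isCountable j (ζ e₀)).hom.vertexMap x = x := by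
    intro j m
    obtain ⟨x, hx, hfix⟩ := hfar (max m (N j)) j
    refine ⟨x, le_trans (le_max_left _ _) hx, ?_⟩
    rw [hact j (max m (N j)) (le_max_right _ _)]
    exact hfix
  have hcrit_c : ∀ n : ℕ, ∃ j₀ : ℕ, ∀ j, j₀ ≤ j →
      ∀ (y : (D.tree j).Vertex) (b b' : (D.tree j).Branch),
        (D.tree j).abuts b = some y → (D.tree j).abuts b' = some y →
        (D.treeProj j).vertexMap y = n + 1 →
        (D.treeAct h36.isCountable j (ζ e₀)).hom.edgeMap ((D.tree j).edgeOf b) = (D.tree j).edgeOf b →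
        (D.treeAct h36.isCountable j (ζ e₀)).hom.edgeMap ((D.tree j).edgeOf b') = (D.tree j).edgeOf b' →
        (∃ (b₂ : (D.tree j).Branch) (v₂ : (D.tree j).Vertex), b₂ ≠ b ∧
          (D.tree j).edgeOf b₂ = (D.tree j).edgeOf b ∧ (D.tree j).abuts b₂ = some v₂ ∧
          (D.treeProj j).vertexMap v₂ = n + 2) →
        (∃ (b₂ : (D.tree j).Branch) (v₂ : (D.tree j).Vertex), b₂ ≠ b' ∧
          (D.tree j).edgeOf b₂ = (D.tree j).edgeOf b' ∧ (D.tree j).abuts b₂ = some v₂ ∧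
          (D.treeProj j).vertexMap v₂ = n) → False := by
    intro n
    obtain ⟨j₀, hj₀⟩ := hcrit n
    refine ⟨j₀, fun j hj y b b' hb hb' hy he he' hup hdown => ?_⟩
    obtain ⟨N', hN'⟩ := hj₀ j hj
    have hk : N' ≤ max N' (N j) := le_max_left _ _
    rw [hact j (max N' (N j)) (le_max_right _ _)] at he he'
    exact hN' (max N' (N j)) hk y b b' hb hb' hy he he' hup hdown
  -- the canonical level data and the escape of `ζ e₀`
  let D' := verticialLevelData_temperedPiChart (h36 := h36)
  have hesc := D'.height_unbounded_of_criticalFree (fun v : ℕ => v) SemiGraph.ray_heightStep (ζ e₀)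
    hfar_c hcrit_c
  have hnv : ¬ ∃ (v : ℕ) (H : Subgroup (𝒢.temperedPiChart h36).G),
      H ∈ verticialSubgroups (𝒢.temperedPiChart h36) v ∧ ζ.toMonoidHom.range ≤ H :=
    D'.not_exists_verticial_of_escaping ζ.toMonoidHom.range
      (D'.escaping_of_criticalFree (fun v : ℕ => v) SemiGraph.ray_heightStep ζ.toMonoidHom.range (ζ e₀)
        hcC hfar_c hcrit_c)
  refine ⟨ζ, ⟨hcpt, fun K hK hCK => le_antisymm ?_ hCK⟩, hnv⟩
  -- the squeeze: `K ≤ C`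
  intro k hk
  have hkC : k ∈ (ζ.toMonoidHom.range : Subgroup (D.temperedPi h36.isCountable)) := by
    rw [hrange]
    refine D.mem_topologicalClosure_of_forall_proj h36.isCountable _ k fun j => ?_
    -- a far edge fixed by `K` at level `j`
    obtain ⟨x, b, hbx, hNx, hKb⟩ := D'.fixedFarEdge_of_heightEscape (fun v : ℕ => v)
      K hK (ζ e₀) (hCK hcC) hesc j (N j + 1)
    -- a point sequence through `x`, over `w`
    obtain ⟨w, P, hP⟩ := D.exists_pointSeq_vertex_eq_at h36.isCountable j x
    have hw : (D.treeProj j).vertexMap x = w := by rw [← hP]; exact P.treeProj_vertexMap_vertex j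
    rcases hβ₀ : (D.treeProj j).branchMap b with ⟨m', s'⟩
    have hbw : 𝒢.graph.abuts (m', s') = some w := by
      have h := (D.treeProj j).abuts_branchMap b x hbx
      rw [hβ₀, hw] at h
      exact h
    have hNw : N j + 1 ≤ w := by rw [← hw]; exact hNx
    clear hw hNx
    -- the re-centred dictionary: `ρ_j(K) ⊆ ⟨u⟩`, `u := σ_j^{b_*(e₀)}` w.r.t. `P'`
    obtain ⟨P', hP'⟩ := P.exists_pointSeq_forall_fix_edge_mem_zpowers j (m', s') hbw b hβ₀
      (by rw [hP]; exact hbx) e₀ hgen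
    have hKu : ∀ g ∈ K, D.proj h36.isCountable j g ∈
        Subgroup.zpowers (P'.gal j (𝒢.brHom (m', s') w hbw e₀)) := fun g hg => hP' g (hKb ⟨g, hg⟩)
    -- the order of `u` is the order of `ρ_j (ζ e₀)`
    have hord : orderOf (P'.gal j (𝒢.brHom (m', s') w hbw e₀)) =
        orderOf (D.proj h36.isCountable j (ζ e₀)) := by
      have hwm : w = (if s' then m' + 1 else m') := (Option.some.inj hbw).symm
      cases s' with
      | true =>
        -- upper branch: `u = σ_j^{up e₀}` over `w = m'+1`, the order of `ρ_j z_{m'}`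
        simp only [if_true] at hwm
        subst hwm
        have hm' : N j ≤ m' := by omega
        rw [hcz j m' hm', hzap m']
        exact P'.orderOf_gal_eq _ j _
      | false =>
        -- lower branch: transfer through the edge fibre to the upper branch at `m'+1`
        simp only [Bool.false_eq_true, if_false] at hwm
        subst w
        have hm' : N j ≤ m' := by omega
        rw [hcz j m' hm', hzap m']
        change orderOf (P'.gal j (𝒢.brHom (m', false) m' hbw e₀)) =
          orderOf ((rayPointSeq (D := D) thetaRay_ham thetaRay_hap thetaRay_hmp P₀ (m' + 1)).gal j
            (𝒢.brHom (m', true) (m' + 1) (thetaRay_hap m') e₀))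
        rw [orderOf_eq_orderOf_iff]
        intro i
        let s : ((D.cover h36.isCountable j).SE (𝒢.graph.edgeOf ((m', false) : ℕ × Bool))).obj.V :=
          ((D.cover h36.isCountable j).glue (m', false) m' hbw).inv.hom.hom (P'.pt j)
        rw [← P'.gal_pow, ← map_pow, ← GaloisLevelData.PointSeq.gal_pow, ← map_pow]
        exact (P'.gal_brHom_eq_one_iff_ρE j (m', false) hbw (e₀ ^ i) s).trans
          ((rayPointSeq (D := D) thetaRay_ham thetaRay_hap thetaRay_hmp P₀ (m' + 1)).gal_brHom_eq_one_iff_ρE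
            j (m', true) (thetaRay_hap m') (e₀ ^ i) s).symm
    -- the squeeze at level `j`: `⟨ρ_j (ζ e₀)⟩ = ⟨u⟩ ∋ ρ_j k`
    have hcu := hKu (ζ e₀) (hCK hcC)
    have hfin_u : IsOfFinOrder (P'.gal j (𝒢.brHom (m', s') w hbw e₀)) := P'.isOfFinOrder_proj_decompHom j _
    have hzp := zpowers_eq_zpowers_of_mem_of_orderOf_eq hcu hord.symm hfin_u
    have hk' : D.proj h36.isCountable j k ∈ Subgroup.zpowers (D.proj h36.isCountable j (ζ e₀)) := by
      rw [hzp]; exact hKu k hk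
    rw [← MonoidHom.map_zpowers] at hk'
    obtain ⟨s, hs, hsk⟩ := Subgroup.mem_map.mp hk'
    exact ⟨s, hs, hsk⟩
  exact hkC

/-- **The escaping procyclic `C` of `𝒢_θ` is a MAXIMAL compact subgroup lying in no verticial subgroup**
(modulo (hcoin), (hcrit); `E = closure⟨e₀⟩`), for the EXPLICIT apartment generators
`z k := ψ_{k+1}(up e₀)` — binders as in abc-iut-L3-t11's `thetaRay_not_compactInVerticialAt_of_hcrit`.
[cite: MochizukiSemiAnbd2006, Thm 3.7(iv) p.41] -/
theorem thetaRay_exists_maximalCompact_escaping_of_hcrit (h37 : (thetaRay G E up low).Thm37Hypotheses)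
    (P₀ : ((thetaRay G E up low).galoisLevelData h37.toProp36Hypotheses).PointSeq h37.isCountable (0 : ℕ))
    (e₀ : E) (hgen : (Subgroup.zpowers e₀).topologicalClosure = ⊤)
    (hcoin : ∀ d : ℕ, ∃ N : ℕ, ∀ k, N ≤ k → (low (k + 1) e₀)⁻¹ * up e₀ ∈ charOpenCore G d)
    (hcrit : let D := (thetaRay G E up low).galoisLevelData h37.toProp36Hypotheses
      let z : ℕ → D.temperedPi h37.isCountable := fun k =>
        (rayPointSeq (D := D) thetaRay_ham thetaRay_hap thetaRay_hmp P₀ (k + 1)).decompHom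
          ((thetaRay G E up low).brHom (k, true) (k + 1) (thetaRay_hap k) e₀)
      ∀ n : ℕ, ∃ j₀ : ℕ, ∀ j, j₀ ≤ j → ∃ N : ℕ, ∀ k, N ≤ k →
        ∀ (y : (D.tree j).Vertex) (b b' : (D.tree j).Branch),
          (D.tree j).abuts b = some y → (D.tree j).abuts b' = some y →
          (D.treeProj j).vertexMap y = n + 1 →
          (D.treeAct h37.isCountable j (z k)).hom.edgeMap ((D.tree j).edgeOf b) = (D.tree j).edgeOf b →
          (D.treeAct h37.isCountable j (z k)).hom.edgeMap ((D.tree j).edgeOf b') = (D.tree j).edgeOf b' →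
          (∃ (b₂ : (D.tree j).Branch) (v₂ : (D.tree j).Vertex), b₂ ≠ b ∧
            (D.tree j).edgeOf b₂ = (D.tree j).edgeOf b ∧ (D.tree j).abuts b₂ = some v₂ ∧
            (D.treeProj j).vertexMap v₂ = n + 2) →
          (∃ (b₂ : (D.tree j).Branch) (v₂ : (D.tree j).Vertex), b₂ ≠ b' ∧
            (D.tree j).edgeOf b₂ = (D.tree j).edgeOf b' ∧ (D.tree j).abuts b₂ = some v₂ ∧
            (D.treeProj j).vertexMap v₂ = n) →
          False) :
    ∃ ζ : E →ₜ* ((thetaRay G E up low).temperedPiChart h37.toProp36Hypotheses).G,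
      IsMaximalCompactSubgroup ζ.toMonoidHom.range ∧
      ¬ ∃ (v : ℕ) (H : Subgroup ((thetaRay G E up low).temperedPiChart h37.toProp36Hypotheses).G),
          H ∈ verticialSubgroups ((thetaRay G E up low).temperedPiChart h37.toProp36Hypotheses) v ∧
          ζ.toMonoidHom.range ≤ H := by
  obtain ⟨hz, -, hfar⟩ := thetaRay_levelEscape_data h37.toProp36Hypotheses P₀ e₀ hcoin
  exact thetaRay_exists_maximalCompact_escaping_of_levelEscape h37 e₀ hgen P₀ _ (fun k => rfl) hz hfar hcrit

end Generic

end Literature.AnabelianGeometry.SemiGraphs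

end
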